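import Literature.NumberTheory.EllipticCurves.BinaryQuarticStabilizer
import Literature.NumberTheory.EllipticCurves.TwoTorsionCardProofs
import Mathlib.AlgebraicGeometry.EllipticCurve.Affine.Point
import HarnessLib

/-!
# The stabiliser of a binary quartic form in `PGL₂(K)` has `#E_{I,J}(K)[2]` elements

Topic `Literature/NumberTheory/EllipticCurves`; companion of `BinaryQuarticStabilizer.lean`, whose
main theorem `BinaryQuartic.pgl2StabilizerCard_eq` computes the order of the stabiliser of a form
`f` (`Δ(f) ≠ 0`) in `PGL₂(K)` as `1 + #{φ ∈ K : φ³ − 3I(f)φ + J(f) = 0}`. Here this is rewritten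
in the form printed by M. Bhargava, A. Shankar, *Binary quartic forms having bounded invariants, and
the boundedness of the average rank of elliptic curves*, Ann. of Math. (2) 181 (2015), Lemma 5.11
of the held arXiv text `arXiv:1006.1002v2` (Thm 3.2 of the published version): **"the size of the
stabilizer of `f` in `PGL₂(K)` is equal to `#E(K)[2]`"**, `E = E_{I,J} : y² = x³ − (I/3)x − J/27`
the curve with invariants `I = I(f)`, `J = J(f)` (p. 31 of the held text)
(`BinaryQuartic.pgl2StabilizerCard_eq_natCard_torsionBy_two`).

Ingredients, both proved here:

* `WeierstrassCurve.ncard_setOf_add_self_eq_zero_eq` — for an elliptic curve `W` over a field with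
  `2 ≠ 0`, **`#{P ∈ W(F) : 2P = O} = #{x : 4x³ + b₂x² + 2b₄x + b₆ = 0} + 1`** (the nonzero
  `2`-torsion points are `(x, −(a₁x + a₃)/2)` for the roots `x` of the `2`-division cubic; the
  inequality `≤ 4` is the tree's `WeierstrassCurve.ncard_setOf_add_self_eq_zero_le`), and its
  `AddSubgroup.torsionBy` form `WeierstrassCurve.natCard_torsionBy_two_eq`;
* the root correspondence `φ = −3x` between `φ³ − 3Iφ + J` and the `2`-division cubic
  `4x³ − (4I/3)x − 4J/27` of `E_{I,J}` (`BinaryQuartic.ncard_resolventRoots_eq`).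

## References

* M. Bhargava, A. Shankar, Ann. of Math. (2) 181 (2015) 191–242 = arXiv:1006.1002, Lemma 5.11
  (arXiv v2 numbering; Thm 3.2 of the published version). [cite: BhargavaShankarAnnals2015, Lemma 5.11 (arXiv:1006.1002v2 numbering)]
* J. H. Silverman, *The Arithmetic of Elliptic Curves*, 2nd ed., III.§2 (doubling, `[2]P = O`),
  Ex. 3.7 — the `2`-torsion points.
-/

noncomputable section

open scoped Classical
open Polynomial

namespace WeierstrassCurve

variable {F : Type*} [Field F] (W : WeierstrassCurve F)

/-- **The points of order dividing `2` on an elliptic curve** over a field with `2 ≠ 0`: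
`#{P ∈ W(F) : P + P = O} = #{x ∈ F : 4x³ + b₂x² + 2b₄x + b₆ = 0} + 1`. The nonzero such points
are exactly `(x, −(a₁x + a₃)/2)` with `x` a root of the `2`-division cubic (Silverman, *AEC*,
III.§2 and Ex. 3.7); `W` elliptic makes these points nonsingular. (A deliberate dot-notation
extension of Mathlib's `WeierstrassCurve` namespace, next to the tree's
`WeierstrassCurve.ncard_setOf_add_self_eq_zero_le`.) [folklore] -/
theorem ncard_setOf_add_self_eq_zero_eq [W.IsElliptic] (h2 : (2 : F) ≠ 0) :
    {P : W.toAffine.Point | P + P = 0}.ncard =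
      {x : F | W.twoTorsionPolynomial.toPoly.IsRoot x}.ncard + 1 := by
  classical
  set g : F[X] := W.twoTorsionPolynomial.toPoly with hg
  have h4 : (4 : F) ≠ 0 := by
    rw [show (4 : F) = 2 * 2 by norm_num]; exact mul_ne_zero h2 h2
  have hg0 : g ≠ 0 := Cubic.ne_zero_of_a_ne_zero (P := W.twoTorsionPolynomial) h4
  have hfin : {x : F | g.IsRoot x}.Finite := by
    refine (g.roots.toFinset.finite_toSet).subset fun x hx ↦ ?_
    simpa [Polynomial.mem_roots hg0] using hx
  -- the point attached to a root `x`: `(x, −(a₁x + a₃)/2)`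
  have hpt : ∀ x : F, g.IsRoot x → W.toAffine.Nonsingular x (-(W.a₁ * x + W.a₃) / 2) := by
    intro x hx
    rw [← Affine.equation_iff_nonsingular, Affine.equation_iff]
    simp only [hg, twoTorsionPolynomial, Cubic.toPoly, IsRoot.def, eval_add, eval_mul, eval_C,
      eval_pow, eval_X, b₂, b₄, b₆] at hx
    field_simp
    linear_combination -hx
  have hneg : ∀ x : F, -(W.a₁ * x + W.a₃) / 2 = W.toAffine.negY x (-(W.a₁ * x + W.a₃) / 2) := by
    intro x
    rw [Affine.negY]
    field_simp
    ring
  set p : F → W.toAffine.Point := fun x ↦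
    if hx : g.IsRoot x then Affine.Point.some x (-(W.a₁ * x + W.a₃) / 2) (hpt x hx) else 0 with hp
  have hpval : ∀ x (hx : g.IsRoot x), p x = Affine.Point.some x (-(W.a₁ * x + W.a₃) / 2) (hpt x hx) :=
    fun x hx ↦ by simp only [hp, dif_pos hx]
  -- the nonzero `2`-torsion points are the `p x`
  have himage : {P : W.toAffine.Point | P + P = 0} \ {0} = p '' {x | g.IsRoot x} := by
    ext P
    simp only [Set.mem_sdiff, Set.mem_setOf_eq, Set.mem_singleton_iff, Set.mem_image]
    constructor
    · rintro ⟨hP, hP0⟩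
      rcases P with _ | ⟨x, y, h⟩
      · exact absurd rfl hP0
      · obtain ⟨hy, hroot⟩ := W.isRoot_twoTorsionPolynomial_of_add_self_eq_zero hP
        have hy' : y = -(W.a₁ * x + W.a₃) / 2 := by
          rw [Affine.negY] at hy
          field_simp
          linear_combination hy
        subst hy'
        exact ⟨x, hroot, hpval x hroot⟩
    · rintro ⟨x, hx, rfl⟩
      rw [hpval x hx]
      exact ⟨Affine.Point.add_self_of_Y_eq (hneg x), Affine.Point.some_ne_zero _⟩
  have hinj : Set.InjOn p {x | g.IsRoot x} := by
    intro x hx x' hx' hxx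
    rw [hpval x hx, hpval x' hx'] at hxx
    simp only [Affine.Point.some.injEq] at hxx
    exact hxx.1
  have h0 : (0 : W.toAffine.Point) ∈ {P : W.toAffine.Point | P + P = 0} := by simp
  rw [← Set.insert_sdiff_singleton (s := {P : W.toAffine.Point | P + P = 0}) (a := 0) |>.trans
    (Set.insert_eq_of_mem h0), himage, Set.ncard_insert_of_notMem ?_ (hfin.image p),
    hinj.ncard_image]
  rintro ⟨x, hx, h⟩
  rw [hpval x hx] at h
  exact Affine.Point.some_ne_zero _ h

/-- **`#W(F)[2] = #{roots of the 2-division cubic} + 1`** for an elliptic curve over a field with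
`2 ≠ 0`, in terms of `AddSubgroup.torsionBy`. [folklore] -/
theorem natCard_torsionBy_two_eq [W.IsElliptic] (h2 : (2 : F) ≠ 0) :
    Nat.card (AddSubgroup.torsionBy W.toAffine.Point (2 : ℤ)) =
      {x : F | W.twoTorsionPolynomial.toPoly.IsRoot x}.ncard + 1 := by
  rw [← SetLike.coe_sort_coe, Nat.card_coe_set_eq]
  have hset : ((AddSubgroup.torsionBy W.toAffine.Point (2 : ℤ) : AddSubgroup W.toAffine.Point) :
      Set W.toAffine.Point) = {P | P + P = 0} := by
    ext P
    simp only [SetLike.mem_coe, Set.mem_setOf_eq]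
    rw [Submodule.mem_toAddSubgroup, Submodule.mem_torsionBy_iff, two_zsmul]
  rw [hset]
  exact W.ncard_setOf_add_self_eq_zero_eq h2

/-- For the short Weierstrass curve `y² = x³ + Ax + B` the roots of the `2`-division cubic
`4x³ + 4Ax + 4B` are the roots of `x³ + Ax + B` (`2 ≠ 0`). [folklore] -/
theorem isRoot_twoTorsionPolynomial_short_iff (h2 : (2 : F) ≠ 0) (A B x : F) :
    (⟨0, 0, 0, A, B⟩ : WeierstrassCurve F).twoTorsionPolynomial.toPoly.IsRoot x ↔
      x ^ 3 + A * x + B = 0 := by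
  have h4 : (4 : F) ≠ 0 := by
    rw [show (4 : F) = 2 * 2 by norm_num]; exact mul_ne_zero h2 h2
  simp only [twoTorsionPolynomial, Cubic.toPoly, IsRoot.def, eval_add, eval_mul, eval_C, eval_pow,
    eval_X, b₂, b₄, b₆]
  constructor
  · intro h
    have : 4 * (x ^ 3 + A * x + B) = 0 := by linear_combination h
    exact (mul_eq_zero.mp this).resolve_left h4
  · intro h
    linear_combination 4 * h

end WeierstrassCurve

namespace Literature.NumberTheory.EllipticCurves

namespace BinaryQuartic

variable {K : Type*} [Field K]

/-- `x ↦ −3x` carries the roots of `x³ − (I/3)x − J/27 = 0` (the `2`-division points of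
`E_{I,J} : y² = x³ − (I/3)x − J/27`) bijectively onto the roots of the resolvent `φ³ − 3Iφ + J`
(`3 ≠ 0`). [folklore] -/
theorem resolventRoots_eq_image (h3 : (3 : K) ≠ 0) (f : BinaryQuartic K) :
    resolventRoots f = (fun x : K ↦ -3 * x) '' {x : K | x ^ 3 + (-f.I / 3) * x + (-f.J / 27) = 0} := by
  have h27 : (27 : K) ≠ 0 := by
    rw [show (27 : K) = 3 * 3 * 3 by norm_num]; exact mul_ne_zero (mul_ne_zero h3 h3) h3
  ext φ
  simp only [resolventRoots, Set.mem_setOf_eq, Set.mem_image]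
  constructor
  · intro h
    refine ⟨-φ / 3, ?_, by field_simp⟩
    field_simp
    linear_combination (-27) * h
  · rintro ⟨x, hx, rfl⟩
    field_simp at hx
    have h3G : (3 : K) * ((-3 * x) ^ 3 - 3 * f.I * (-3 * x) + f.J) = 0 := by
      linear_combination -hx
    exact (mul_eq_zero.mp h3G).resolve_left h3

/-- The resolvent of `f` and the cubic `x³ − (I/3)x − J/27` of `E_{I,J}` have the same number of
`K`-rational roots (`3 ≠ 0`). [folklore] -/
theorem ncard_resolventRoots_eq (h3 : (3 : K) ≠ 0) (f : BinaryQuartic K) :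
    (resolventRoots f).ncard = {x : K | x ^ 3 + (-f.I / 3) * x + (-f.J / 27) = 0}.ncard := by
  rw [resolventRoots_eq_image h3 f]
  refine Set.ncard_image_of_injective _ fun x x' h ↦ ?_
  have : (-3 : K) * (x - x') = 0 := by linear_combination h
  exact sub_eq_zero.mp ((mul_eq_zero.mp this).resolve_left (neg_ne_zero.mpr h3))

/-- `E_{I,J} : y² = x³ − (I/3)x − J/27` is an elliptic curve when `Δ(f) ≠ 0`: its discriminant is
`16·Δ(f)` (`2 ≠ 0`, `3 ≠ 0`). [cite: BhargavaShankarAnnals2015, §5 p. 31 (E_{I,J}; arXiv:1006.1002v2 numbering)] -/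
theorem isElliptic_curveOfInvariants (h2 : (2 : K) ≠ 0) (h3 : (3 : K) ≠ 0) {f : BinaryQuartic K}
    (hΔ : f.disc ≠ 0) : (⟨0, 0, 0, -f.I / 3, -f.J / 27⟩ : WeierstrassCurve K).IsElliptic := by
  rw [WeierstrassCurve.isElliptic_iff]
  have h27 : (27 : K) ≠ 0 := by
    rw [show (27 : K) = 3 * 3 * 3 by norm_num]; exact mul_ne_zero (mul_ne_zero h3 h3) h3
  have h16 : (16 : K) ≠ 0 := by
    rw [show (16 : K) = 2 * 2 * 2 * 2 by norm_num]
    exact mul_ne_zero (mul_ne_zero (mul_ne_zero h2 h2) h2) h2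
  have hD : (⟨0, 0, 0, -f.I / 3, -f.J / 27⟩ : WeierstrassCurve K).Δ = 16 * f.disc := by
    have h := twentySeven_mul_disc f
    simp only [WeierstrassCurve.Δ, WeierstrassCurve.b₂, WeierstrassCurve.b₄, WeierstrassCurve.b₆,
      WeierstrassCurve.b₈]
    field_simp
    linear_combination (-432) * h
  rw [hD]
  exact (mul_ne_zero h16 hΔ).isUnit

/-- **Bhargava–Shankar, Lemma 5.11 (Thm 3.2 of the published version), as printed: the size of the
stabiliser of `f` in `PGL₂(K)` (twisted action) equals `#E_{I,J}(K)[2]`**, where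
`E_{I,J} : y² = x³ − (I/3)x − J/27` is the elliptic curve with invariants `I = I(f)`, `J = J(f)`
(`BhargavaShankarLocalMasses.curveOfInvariants`); valid for every field `K` with `2 ≠ 0`, `3 ≠ 0`
and every `f` with `Δ(f) ≠ 0` (the source assumes `I ≠ 0`, `J ≠ 0`). The `2`-torsion subgroup is
`AddSubgroup.torsionBy _ 2` of Mathlib's group of affine points, as in the tree's local masses
`localSelmerRatio`. [cite: BhargavaShankarAnnals2015, Lemma 5.11 (arXiv:1006.1002v2 numbering)] -/
theorem pgl2StabilizerCard_eq_natCard_torsionBy_two (h2 : (2 : K) ≠ 0) (h3 : (3 : K) ≠ 0)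
    {f : BinaryQuartic K} (hΔ : f.disc ≠ 0) :
    pgl2StabilizerCard f =
      Nat.card (AddSubgroup.torsionBy
        (⟨0, 0, 0, -f.I / 3, -f.J / 27⟩ : WeierstrassCurve K).toAffine.Point (2 : ℤ)) := by
  haveI := isElliptic_curveOfInvariants h2 h3 hΔ
  rw [WeierstrassCurve.natCard_torsionBy_two_eq _ h2, pgl2StabilizerCard_eq h2 h3 hΔ,
    ncard_resolventRoots_eq h3, add_comm]
  congr 2
  ext x
  exact (WeierstrassCurve.isRoot_twoTorsionPolynomial_short_iff h2 _ _ x).symm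

/-- **`#E_{I,J}(K)[2] ≤ 4`, hence the stabiliser has at most four elements** — restated through
the curve. [cite: BhargavaShankarAnnals2015, Lemma 5.11 (arXiv:1006.1002v2 numbering)] -/
theorem natCard_torsionBy_two_curveOfInvariants_le (h2 : (2 : K) ≠ 0) (h3 : (3 : K) ≠ 0)
    {f : BinaryQuartic K} (hΔ : f.disc ≠ 0) :
    Nat.card (AddSubgroup.torsionBy
        (⟨0, 0, 0, -f.I / 3, -f.J / 27⟩ : WeierstrassCurve K).toAffine.Point (2 : ℤ)) ≤ 4 := by
  rw [← pgl2StabilizerCard_eq_natCard_torsionBy_two h2 h3 hΔ]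
  exact pgl2StabilizerCard_le_four h2 h3 hΔ

end BinaryQuartic

end Literature.NumberTheory.EllipticCurves

end
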